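import Mathlib
import Summits.MatrixMultiplication.MatrixMultiplication.Theses.LevelGradedCohnUmans

/-!
# `SnLevelDesigns` (stmt-MatrixMultiplication-7613), line `garnir-annihilator`:
# K1 `stub_xzIndependence` — the matroid form of the two-set core

Crux `Summit.MatrixMultiplication.MatrixMultiplication.Theses.LevelGradedCohnUmans.SnLevelDesigns`;
skeleton `Cruxes/SnLevelDesigns/Lines/garnir_annihilator.lean` (lead c2 reshape 5, registered stub K1);
this file proves the registered stub `stub_xzIndependence` verbatim (name + signature, tree-only
vocabulary) and lands `--supports stmt-MatrixMultiplication-7613`.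

Collapsing the middle set of a `k`-token separated triple to `Y = {1}` leaves a separated PAIR
`(X, Z)`: the quadruple product is `x⁻¹ * 1 * 1⁻¹ * z = x⁻¹ z` and the required pattern is
`f_c(x⁻¹ z) = [x = x₀ ∧ z = z₀]` for the separator `c` of `(x₀, z₀)`. This stub is the exact
linear-algebra form of that two-set core: `(X, {1}, Z)` is `k`-token separated iff
(i) `(x, z) ↦ x⁻¹ z` is injective on `X ×ˢ Z` and (ii) the evaluation functionals
`ev_{(x,z)} : c ↦ Σ_p c p ((x⁻¹ z) ∘ p)`, `(x, z) ∈ X ×ˢ Z`, are linearly independent in the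
ℂ-space of functions on coefficient tables (an independent product set of the token matroid).

Proof (Mathlib only).
* (→) `xzi_sep_eval`: with `y = y' = 1` the separator of `(x₀, z₀)` takes the value
  `[x = x₀ ∧ z = z₀]` on the pair `(x, z)`. Injectivity (`xzi_injOn`): two pairs with the same
  product give the same value of the separator of the first pair, i.e. `1 = [pairs equal]`.
  Independence (`xzi_linearIndependent`, `Fintype.linearIndependent_iff`): evaluate a vanishing
  combination `Σ_t g t • ev_t = 0` at the separator of `t₀`; only the `t₀` term survives.
* (←) `xzi_exists_preimage` packages the evaluations as a linear map `c ↦ (t ↦ ev_t c)` into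
  `ℂ^{X ×ˢ Z}`; by `span_flip_eq_top_iff_linearIndependent` independent functions on a set have
  jointly spanning value vectors, and the range of a linear map is already a subspace, so the map is
  surjective; the preimage of the indicator of `(x₀, z₀)` is the required separator
  (`xzi_separated_of_linearIndependent`).
-/

-- the problem path repeats `MatrixMultiplication` (summit = problem), as in every file of this line
set_option linter.dupNamespace false

namespace Summit.MatrixMultiplication.MatrixMultiplication.Theorems.SnLevelDesigns

open scoped BigOperators

/-- Collapse of the middle set: with `y = y' = 1` the quadruple product `x⁻¹ y y'⁻¹ z` is `x⁻¹ z`. -/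
theorem xzi_quad_one {n : ℕ} (x z : Equiv.Perm (Fin n)) : x⁻¹ * 1 * 1⁻¹ * z = x⁻¹ * z := by
  rw [mul_one, inv_one, mul_one]

/-- The separator `c` of `(x₀, z₀)` against the middle set `{1}` takes the value `[x = x₀ ∧ z = z₀]`
on every pair `(x, z) ∈ X × Z` (specialise the separation clause to `y = y' = 1`). -/
theorem xzi_sep_eval {n k : ℕ} {X Z : Finset (Equiv.Perm (Fin n))} {x₀ z₀ : Equiv.Perm (Fin n)}
    {c : (Fin k → Fin n) → (Fin k → Fin n) → ℂ}
    (hc : ∀ x ∈ X, ∀ y ∈ ({1} : Finset (Equiv.Perm (Fin n))),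
      ∀ y' ∈ ({1} : Finset (Equiv.Perm (Fin n))), ∀ z ∈ Z,
        (∑ p : Fin k → Fin n, c p (⇑(x⁻¹ * y * y'⁻¹ * z) ∘ p)) =
          if x = x₀ ∧ y = y' ∧ z = z₀ then 1 else 0)
    {x z : Equiv.Perm (Fin n)} (hx : x ∈ X) (hz : z ∈ Z) :
    (∑ p : Fin k → Fin n, c p (⇑(x⁻¹ * z) ∘ p)) = if x = x₀ ∧ z = z₀ then 1 else 0 := by
  have h := hc x hx 1 (Finset.mem_singleton_self 1) 1 (Finset.mem_singleton_self 1) z hz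
  rw [xzi_quad_one] at h
  rw [h]
  by_cases hxz : x = x₀ ∧ z = z₀
  · rw [if_pos ⟨hxz.1, rfl, hxz.2⟩, if_pos hxz]
  · rw [if_neg (fun h' => hxz ⟨h'.1, h'.2.2⟩), if_neg hxz]

/-- (→, injectivity) If `(X, {1}, Z)` is `k`-token separated then `(x, z) ↦ x⁻¹ z` is injective on
`X ×ˢ Z`: two pairs with the same product receive the same value from the separator of the first
pair, namely `1` and `[the pairs are equal]`. -/
theorem xzi_injOn {n k : ℕ} {X Z : Finset (Equiv.Perm (Fin n))}
    (h : ∀ x₀ ∈ X, ∀ z₀ ∈ Z, ∃ c : (Fin k → Fin n) → (Fin k → Fin n) → ℂ,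
      ∀ x ∈ X, ∀ y ∈ ({1} : Finset (Equiv.Perm (Fin n))),
        ∀ y' ∈ ({1} : Finset (Equiv.Perm (Fin n))), ∀ z ∈ Z,
          (∑ p : Fin k → Fin n, c p (⇑(x⁻¹ * y * y'⁻¹ * z) ∘ p)) =
            if x = x₀ ∧ y = y' ∧ z = z₀ then 1 else 0) :
    Set.InjOn (fun p : Equiv.Perm (Fin n) × Equiv.Perm (Fin n) => p.1⁻¹ * p.2) ↑(X ×ˢ Z) := by
  intro a ha b hb hab
  obtain ⟨ha1, ha2⟩ := Finset.mem_product.1 (Finset.mem_coe.1 ha)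
  obtain ⟨hb1, hb2⟩ := Finset.mem_product.1 (Finset.mem_coe.1 hb)
  obtain ⟨c, hc⟩ := h a.1 ha1 a.2 ha2
  have hab' : a.1⁻¹ * a.2 = b.1⁻¹ * b.2 := hab
  have h1 := xzi_sep_eval hc ha1 ha2
  have h2 := xzi_sep_eval hc hb1 hb2
  rw [if_pos ⟨rfl, rfl⟩, hab', h2] at h1
  by_contra hne
  have hne' : ¬ (b.1 = a.1 ∧ b.2 = a.2) := fun hh => hne (Prod.ext hh.1.symm hh.2.symm)
  rw [if_neg hne'] at h1
  exact zero_ne_one h1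

/-- (→, independence) If `(X, {1}, Z)` is `k`-token separated then the evaluation functionals
`ev_{(x,z)} : c ↦ Σ_p c p ((x⁻¹ z) ∘ p)` are linearly independent: evaluating a vanishing combination
`Σ_t g t • ev_t = 0` at the separator of `t₀` leaves `g t₀ = 0` (`Fintype.linearIndependent_iff`). -/
theorem xzi_linearIndependent {n k : ℕ} {X Z : Finset (Equiv.Perm (Fin n))}
    (h : ∀ x₀ ∈ X, ∀ z₀ ∈ Z, ∃ c : (Fin k → Fin n) → (Fin k → Fin n) → ℂ,
      ∀ x ∈ X, ∀ y ∈ ({1} : Finset (Equiv.Perm (Fin n))),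
        ∀ y' ∈ ({1} : Finset (Equiv.Perm (Fin n))), ∀ z ∈ Z,
          (∑ p : Fin k → Fin n, c p (⇑(x⁻¹ * y * y'⁻¹ * z) ∘ p)) =
            if x = x₀ ∧ y = y' ∧ z = z₀ then 1 else 0) :
    LinearIndependent ℂ (fun t : ↥(X ×ˢ Z) =>
      fun c : (Fin k → Fin n) → (Fin k → Fin n) → ℂ =>
        ∑ p : Fin k → Fin n, c p (⇑((t : Equiv.Perm (Fin n) × Equiv.Perm (Fin n)).1⁻¹ *
          (t : Equiv.Perm (Fin n) × Equiv.Perm (Fin n)).2) ∘ p)) := by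
  classical
  rw [Fintype.linearIndependent_iff]
  intro g hg t₀
  obtain ⟨hx₀, hz₀⟩ := Finset.mem_product.1 t₀.2
  obtain ⟨c, hc⟩ := h _ hx₀ _ hz₀
  have hgc := congrFun hg c
  simp only [Finset.sum_apply, Pi.smul_apply, smul_eq_mul, Pi.zero_apply] at hgc
  rw [Finset.sum_eq_single t₀ ?_ (fun ht₀ => absurd (Finset.mem_univ t₀) ht₀),
    xzi_sep_eval hc hx₀ hz₀, if_pos ⟨rfl, rfl⟩, mul_one] at hgc
  · exact hgc
  · intro t _ ht
    obtain ⟨hx, hz⟩ := Finset.mem_product.1 t.2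
    rw [xzi_sep_eval hc hx hz, if_neg (fun hh => ht (Subtype.ext (Prod.ext hh.1 hh.2))), mul_zero]

/-- (←, surjectivity) If the evaluation functionals `ev_t : c ↦ Σ_p c p ((t.1⁻¹ t.2) ∘ p)`,
`t ∈ X ×ˢ Z`, are linearly independent functions on the coefficient tables, then the joint
evaluation map `c ↦ (ev_t c)_t` is onto `ℂ^{X ×ˢ Z}`: it is linear in `c`, by
`span_flip_eq_top_iff_linearIndependent` its values span, and the range of a linear map is already a
subspace. Stated as: every vector `w` on `X ×ˢ Z` is `(ev_t c)_t` for some table `c`. -/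
theorem xzi_exists_preimage {n k : ℕ} {X Z : Finset (Equiv.Perm (Fin n))}
    (hli : LinearIndependent ℂ (fun t : ↥(X ×ˢ Z) =>
      fun c : (Fin k → Fin n) → (Fin k → Fin n) → ℂ =>
        ∑ p : Fin k → Fin n, c p (⇑((t : Equiv.Perm (Fin n) × Equiv.Perm (Fin n)).1⁻¹ *
          (t : Equiv.Perm (Fin n) × Equiv.Perm (Fin n)).2) ∘ p)))
    (w : ↥(X ×ˢ Z) → ℂ) :
    ∃ c : (Fin k → Fin n) → (Fin k → Fin n) → ℂ, ∀ t : ↥(X ×ˢ Z),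
      (∑ p : Fin k → Fin n, c p (⇑((t : Equiv.Perm (Fin n) × Equiv.Perm (Fin n)).1⁻¹ *
        (t : Equiv.Perm (Fin n) × Equiv.Perm (Fin n)).2) ∘ p)) = w t := by
  -- the joint evaluation map, linear in the table `c`
  let Φ : ((Fin k → Fin n) → (Fin k → Fin n) → ℂ) →ₗ[ℂ] (↥(X ×ˢ Z) → ℂ) :=
    { toFun := fun c t => ∑ p : Fin k → Fin n,
        c p (⇑((t : Equiv.Perm (Fin n) × Equiv.Perm (Fin n)).1⁻¹ *
          (t : Equiv.Perm (Fin n) × Equiv.Perm (Fin n)).2) ∘ p)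
      map_add' := fun c d => by
        funext t
        simp only [Pi.add_apply, Finset.sum_add_distrib]
      map_smul' := fun a c => by
        funext t
        simp only [Pi.smul_apply, smul_eq_mul, RingHom.id_apply, Finset.mul_sum] }
  have hsurj : Function.Surjective Φ := by
    have hspan := span_flip_eq_top_iff_linearIndependent.2 hli
    rw [← LinearMap.range_eq_top, ← Submodule.span_eq (LinearMap.range Φ), LinearMap.coe_range]
    exact hspan
  obtain ⟨c, hc⟩ := hsurj w
  exact ⟨c, fun t => congrFun hc t⟩

/-- (←) Independent evaluation functionals separate: for `(x₀, z₀) ∈ X × Z` a preimage under the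
joint evaluation map of the indicator of `(x₀, z₀)` is a table `c` with
`f_c(x⁻¹ · 1 · 1⁻¹ · z) = [x = x₀ ∧ 1 = 1 ∧ z = z₀]` on `X × {1} × {1} × Z`. -/
theorem xzi_separated_of_linearIndependent {n k : ℕ} {X Z : Finset (Equiv.Perm (Fin n))}
    (hli : LinearIndependent ℂ (fun t : ↥(X ×ˢ Z) =>
      fun c : (Fin k → Fin n) → (Fin k → Fin n) → ℂ =>
        ∑ p : Fin k → Fin n, c p (⇑((t : Equiv.Perm (Fin n) × Equiv.Perm (Fin n)).1⁻¹ *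
          (t : Equiv.Perm (Fin n) × Equiv.Perm (Fin n)).2) ∘ p))) :
    ∀ x₀ ∈ X, ∀ z₀ ∈ Z, ∃ c : (Fin k → Fin n) → (Fin k → Fin n) → ℂ,
      ∀ x ∈ X, ∀ y ∈ ({1} : Finset (Equiv.Perm (Fin n))),
        ∀ y' ∈ ({1} : Finset (Equiv.Perm (Fin n))), ∀ z ∈ Z,
          (∑ p : Fin k → Fin n, c p (⇑(x⁻¹ * y * y'⁻¹ * z) ∘ p)) =
            if x = x₀ ∧ y = y' ∧ z = z₀ then 1 else 0 := by
  classical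
  intro x₀ hx₀ z₀ hz₀
  set t₀ : ↥(X ×ˢ Z) := ⟨(x₀, z₀), Finset.mem_product.2 ⟨hx₀, hz₀⟩⟩ with ht₀
  obtain ⟨c, hc⟩ := xzi_exists_preimage hli (fun t => if t = t₀ then 1 else 0)
  refine ⟨c, fun x hx y hy y' hy' z hz => ?_⟩
  rw [Finset.mem_singleton] at hy hy'
  subst hy
  subst hy'
  rw [xzi_quad_one]
  have hxz := hc ⟨(x, z), Finset.mem_product.2 ⟨hx, hz⟩⟩
  change (∑ p : Fin k → Fin n, c p (⇑(x⁻¹ * z) ∘ p)) = _ at hxz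
  rw [hxz, ht₀]
  by_cases h : x = x₀ ∧ z = z₀
  · rw [if_pos (Subtype.ext (Prod.ext h.1 h.2)), if_pos ⟨h.1, rfl, h.2⟩]
  · rw [if_neg (fun hh => h (Prod.mk.inj (congrArg Subtype.val hh))),
      if_neg (fun hh => h ⟨hh.1, hh.2.2⟩)]

/-- **`stub_xzIndependence`** (registered stub K1 of crux stmt-MatrixMultiplication-7613, line
`garnir-annihilator`; the matroid form of the two-set core). For `X, Z ⊆ 𝔖ₙ`, the triple
`(X, {1}, Z)` is `k`-token separated iff (i) `(x, z) ↦ x⁻¹ z` is injective on `X ×ˢ Z` and (ii) the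
evaluation functionals `c ↦ Σ_p c p ((x⁻¹ z) ∘ p)`, `(x, z) ∈ X ×ˢ Z`, are linearly independent as
functions on the coefficient tables. (→): `xzi_injOn`, `xzi_linearIndependent` (evaluate at a
separator). (←): `xzi_separated_of_linearIndependent` (independent functionals are jointly
surjective onto `ℂ^{X ×ˢ Z}`, so the indicator of `(x₀, z₀)` is attained; (i) is not even needed). -/
theorem stub_xzIndependence :
    ∀ (n k : ℕ) (X Z : Finset (Equiv.Perm (Fin n))),
      (∀ x₀ ∈ X, ∀ z₀ ∈ Z, ∃ c : (Fin k → Fin n) → (Fin k → Fin n) → ℂ,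
          ∀ x ∈ X, ∀ y ∈ ({1} : Finset (Equiv.Perm (Fin n))), ∀ y' ∈ ({1} : Finset (Equiv.Perm (Fin n))),
            ∀ z ∈ Z, (∑ p : Fin k → Fin n, c p (⇑(x⁻¹ * y * y'⁻¹ * z) ∘ p)) =
              if x = x₀ ∧ y = y' ∧ z = z₀ then 1 else 0) ↔
        (Set.InjOn (fun p : Equiv.Perm (Fin n) × Equiv.Perm (Fin n) => p.1⁻¹ * p.2) ↑(X ×ˢ Z) ∧
          LinearIndependent ℂ (fun t : ↥(X ×ˢ Z) =>
            fun c : (Fin k → Fin n) → (Fin k → Fin n) → ℂ =>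
              ∑ p : Fin k → Fin n, c p (⇑((t : Equiv.Perm (Fin n) × Equiv.Perm (Fin n)).1⁻¹ *
                (t : Equiv.Perm (Fin n) × Equiv.Perm (Fin n)).2) ∘ p))) := by
  intro n k X Z
  constructor
  · intro h
    exact ⟨xzi_injOn h, xzi_linearIndependent h⟩
  · rintro ⟨-, hli⟩
    exact xzi_separated_of_linearIndependent hli

end Summit.MatrixMultiplication.MatrixMultiplication.Theorems.SnLevelDesigns
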